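import Summits.QuantumFields.YangMills.Theorems.SwapVirialDeficitBlowUpChartDeficitBox
import Summits.QuantumFields.YangMills.Theorems.SwapVirialDeficitQuantitativeLaplaceCoerciveOfGrowth
import HarnessLib

/-!
# UNIFORM COERCIVITY OF THE FOLLOWER HESSIAN AT `U ≡ 1` OVER THE NEAR-FLAT BASE, modulo the quartic Taylor datum — §4(a) of w2 g58's Morse–Bott road v2
# as ONE named statement (free-hands support of ⟨stmt-QuantumFields-24197⟩ `SwapVirialDeficit.SwapGluedStiffness`)

Architecture v2 (memo w2-g58-memo-24197-fibred-laplace.md §4; line of record, LEAD g97) fibres the σ-ring chart over the near-flat leaders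
`N = {C : relations ≤ s₀}` with fibre = the followers, and needs the `hcoer` hypothesis of ✓`laplaceMethod_quantitative_fibred_of_taylor` for the follower
Hessian block with a constant `λ_F(L) ≥ L^{−k}` INDEPENDENT of the hub angle.  Everything except the fourth-order jet bound is now in the tree; this file composes it:

* ★★★ `follower_coercivity_of_taylor` — for an ABSTRACT follower chart `Ψ : V → (Fol L → SU2)` on a real inner-product space `V` that is
  FROBENIUS-COMPARABLE on the ball (`κ‖y‖² ≤ Σ_i ‖Ψ(y)_i − 1‖²_F` for `‖y‖ ≤ R`; e.g. exp or gnomonic coordinates, `κ = O(1)`), every leader tuple `C` with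
  σ-relations `≤ s`, and every symmetric candidate `A` carrying the quartic TAYLOR DATUM of `y ↦ F̂(C, Ψ y)` at `y = 0` with constant `F̂(C,1)` and an arbitrary
  odd part (`∃ σ odd, |F̂(C,Ψy) − F̂(C,1) − ½⟪Ay,y⟫ − σ y| ≤ B₄‖y‖⁴` on `‖y‖ ≤ R`):
  `(2κ/(2304·L⁶·|Fol L|) − 600·L⁴·s²/R² − 2B₄R²)·‖y‖² ≤ ⟪A y, y⟫` for EVERY `y`
  (✓`chartDeficit_ge_sum_follower_frobNorm_sq` growth + ✓`chartDeficit_one_le_of_relations` thin-toron bound + ✓`inner_ge_of_growth_of_taylor_offset`);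
* ★★ `follower_coercivity_of_taylor_half` — the tuned form: with `μ := κ/(2304·L⁶·|Fol L|)`, `R² ≤ μ/(2B₄)`… precisely under `2B₄R² ≤ μ/2` and
  `600L⁴s² ≤ μR²/2·…` (stated as the two explicit smallness hypotheses) the constant is `≥ μ/…`; we state the clean sufficient condition
  `600·L⁴·s² ≤ μ·R²/4 ∧ B₄·R² ≤ μ/8 ⟹ μ·‖y‖² ≤ ⟪A y, y⟫` (`μ = 2κ/(2304L⁶|Fol L|)·(1/2)`… see the statement) — all thresholds polynomial in `L`, none in the hub angle.
What is NOT here: the Taylor datum itself (order-4 jets of the chart deficit in follower directions: fcl-p3 g47's J-series is order 3 so far; (M2)(b)).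

HONEST LABEL: composition of landed inequalities; (M4) ∕ ⟨24197⟩ (window-uniform) ∕ ⟨24196⟩ ∕ ⟨24194⟩ ∕ ⟨24497⟩ OPEN; own crux ⟨22884⟩ OPEN (blocked-on ⟨19935⟩); no crux,
rung of record or summit is proved; the Yang–Mills mass gap is NOT proved; no summit is proved by a line.  THEOREMS ONLY (0 `def`, 0 `sorry`), standard axioms.
Width seat ym-line-sfw-p2-w3 g65 (cell ym-idea-1, free hands), `--supports stmt-QuantumFields-24197`.  References: [cite: Luscher1983, §2]; [folklore].
-/

set_option autoImplicit false

noncomputable section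

open MeasureTheory
open scoped BigOperators InnerProductSpace
open Literature.MathematicalPhysics.QuantumFieldTheory hiding SU2
open Literature.MathematicalPhysics.QuantumLattice

namespace Summit.QuantumFields.YangMills.Theorems.SwapVirialDeficit.BlowUpRing

open Summit.QuantumFields.YangMills.Theorems.FemtoTransferGap
open Summit.QuantumFields.YangMills.Theorems.FemtoTransferGap.TT
open Summit.QuantumFields.YangMills.Theorems.VirialFluxGap.RingDeficit
open Summit.QuantumFields.YangMills.Theorems.SwapVirialDeficit.SwapRing
open Summit.QuantumFields.YangMills.Theorems.QuantitativeLaplace (inner_ge_of_growth_of_taylor_offset)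

variable {L : ℕ} [NeZero L]
variable {V : Type*} [NormedAddCommGroup V] [InnerProductSpace ℝ V]

/-- ★★★ **FOLLOWER COERCIVITY AT `U ≡ 1`, UNIFORM OVER NEAR-FLAT LEADERS, MODULO THE QUARTIC TAYLOR DATUM.**  Let `Ψ : V → (Fol L → SU2)` be any follower
chart that is Frobenius-comparable on the ball `‖y‖ ≤ R` (`κ‖y‖² ≤ Σ_i ‖Ψ(y)_i − 1‖²_F`), `C` a leader tuple with all σ-relations `≤ s`, and `A : V →ₗ[ℝ] V` a
candidate Hessian with the Taylor datum `∃ σ odd, |F̂(C, Ψ y) − F̂(C, 1) − ½⟪A y, y⟫ − σ y| ≤ B₄‖y‖⁴` on the ball.  Then for every `y`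
`(2κ/(2304·L⁶·|Fol L|) − 2·(300·L⁴·s²)/R² − 2B₄R²)·‖y‖² ≤ ⟪A y, y⟫` — hub-angle independent, polynomial in `L`. [cite: Luscher1983, §2] -/
theorem follower_coercivity_of_taylor (Ψ : V → (Fol L → SU2)) {κ R s B₄ : ℝ} (hR : 0 < R) (hs : 0 ≤ s)
    (hΨ : ∀ y : V, ‖y‖ ≤ R → κ * ‖y‖ ^ 2 ≤ ∑ i : Fol L, frobNorm (((Ψ y i : SU2) : Matrix (Fin 2) (Fin 2) ℂ) - 1) ^ 2)
    (C : Fin 4 → SU2)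
    (hCC : ∀ μ ν : Fin 3, frobNorm (((C (Fin.castSucc μ) * C (Fin.castSucc ν) : SU2) : Matrix (Fin 2) (Fin 2) ℂ) -
        ((C (Fin.castSucc ν) * C (Fin.castSucc μ) : SU2) : Matrix (Fin 2) (Fin 2) ℂ)) ≤ s)
    (hσ : ∀ μ : Fin 3, frobNorm (((C (Fin.last 3) * C (Fin.castSucc (Equiv.swap (0 : Fin 3) 1 μ)) : SU2) : Matrix (Fin 2) (Fin 2) ℂ) -
        ((C (Fin.castSucc μ) * C (Fin.last 3) : SU2) : Matrix (Fin 2) (Fin 2) ℂ)) ≤ s)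
    {A : V →ₗ[ℝ] V}
    (hT : ∃ σ : V → ℝ, (∀ y, σ (-y) = -σ y) ∧ ∀ y : V, ‖y‖ ≤ R →
      |chartDeficit L (fun _ => false) (fun _ => 1) (C, Ψ y) - chartDeficit L (fun _ => false) (fun _ => 1) (C, fun _ => 1) -
          (1 / 2) * ⟪A y, y⟫_ℝ - σ y| ≤ B₄ * ‖y‖ ^ 4)
    (y : V) :
    (2 * (κ / (2304 * (L : ℝ) ^ 6 * (Fintype.card (Fol L) : ℝ))) - 2 * (300 * (L : ℝ) ^ 4 * s ^ 2) / R ^ 2 - 2 * B₄ * R ^ 2) * ‖y‖ ^ 2 ≤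
      ⟪A y, y⟫_ℝ := by
  have hL : (0 : ℝ) < L := by exact_mod_cast NeZero.pos L
  have hcard : 0 < Fintype.card (Fol L) := by rw [card_fol]; have := Nat.one_le_pow 4 L NeZero.one_le; omega
  have hK : (0 : ℝ) < 2304 * (L : ℝ) ^ 6 * (Fintype.card (Fol L) : ℝ) := by positivity
  -- growth: `(κ/K)·‖y‖² ≤ F̂(C, Ψ y)` on the ball
  have hgrowth : ∀ y : V, ‖y‖ ≤ R → κ / (2304 * (L : ℝ) ^ 6 * (Fintype.card (Fol L) : ℝ)) * ‖y‖ ^ 2 ≤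
      chartDeficit L (fun _ => false) (fun _ => 1) (C, Ψ y) := by
    intro y hy
    have h1 := chartDeficit_ge_sum_follower_frobNorm_sq (L := L) (C, Ψ y)
    have h2 := hΨ y hy
    calc κ / (2304 * (L : ℝ) ^ 6 * (Fintype.card (Fol L) : ℝ)) * ‖y‖ ^ 2
        = (2304 * (L : ℝ) ^ 6 * (Fintype.card (Fol L) : ℝ))⁻¹ * (κ * ‖y‖ ^ 2) := by rw [div_eq_inv_mul]; ring
      _ ≤ (2304 * (L : ℝ) ^ 6 * (Fintype.card (Fol L) : ℝ))⁻¹ * ∑ i : Fol L, frobNorm (((Ψ y i : SU2) : Matrix (Fin 2) (Fin 2) ℂ) - 1) ^ 2 :=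
          mul_le_mul_of_nonneg_left h2 (inv_nonneg.2 hK.le)
      _ ≤ _ := h1
  -- the thin-toron constant `f₀ = F̂(C,1) ≤ 300 L⁴ s²`
  have hf₀ := chartDeficit_one_le_of_relations (L := L) C hs hCC hσ
  have hmain := inner_ge_of_growth_of_taylor_offset (A := A) (f := fun y => chartDeficit L (fun _ => false) (fun _ => 1) (C, Ψ y))
    (f₀ := chartDeficit L (fun _ => false) (fun _ => 1) (C, fun _ => 1)) hR hgrowth hT y
  -- monotonicity of the constant in `f₀`
  have hR2 : 0 < R ^ 2 := by positivity
  have hmono : 2 * (κ / (2304 * (L : ℝ) ^ 6 * (Fintype.card (Fol L) : ℝ))) - 2 * (300 * (L : ℝ) ^ 4 * s ^ 2) / R ^ 2 - 2 * B₄ * R ^ 2 ≤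
      2 * (κ / (2304 * (L : ℝ) ^ 6 * (Fintype.card (Fol L) : ℝ))) -
        2 * chartDeficit L (fun _ => false) (fun _ => 1) (C, fun _ => 1) / R ^ 2 - 2 * B₄ * R ^ 2 := by
    have : 2 * chartDeficit L (fun _ => false) (fun _ => 1) (C, fun _ => 1) / R ^ 2 ≤ 2 * (300 * (L : ℝ) ^ 4 * s ^ 2) / R ^ 2 := by
      gcongr
    linarith
  calc _ ≤ (2 * (κ / (2304 * (L : ℝ) ^ 6 * (Fintype.card (Fol L) : ℝ))) -
        2 * chartDeficit L (fun _ => false) (fun _ => 1) (C, fun _ => 1) / R ^ 2 - 2 * B₄ * R ^ 2) * ‖y‖ ^ 2 :=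
        mul_le_mul_of_nonneg_right hmono (by positivity)
    _ ≤ _ := hmain

/-- ★★ **The tuned sufficient condition**: write `μ := κ/(2304·L⁶·|Fol L|)`.  If `2·(300L⁴s²) ≤ μ·R²/2` (relations small against the ball) and
`2B₄R² ≤ μ/2` (ball small against the quartic constant) then `μ·‖y‖² ≤ ⟪A y, y⟫` — the follower block is uniformly `μ`-coercive at `U ≡ 1` over the whole near-flat
base `{relations ≤ s}`, every threshold polynomial in `L` and free of the hub angle. [cite: Luscher1983, §2] -/
theorem follower_coercivity_of_taylor_half (Ψ : V → (Fol L → SU2)) {κ R s B₄ : ℝ} (hR : 0 < R) (hs : 0 ≤ s)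
    (hΨ : ∀ y : V, ‖y‖ ≤ R → κ * ‖y‖ ^ 2 ≤ ∑ i : Fol L, frobNorm (((Ψ y i : SU2) : Matrix (Fin 2) (Fin 2) ℂ) - 1) ^ 2)
    (hsmall₁ : 2 * (300 * (L : ℝ) ^ 4 * s ^ 2) ≤ κ / (2304 * (L : ℝ) ^ 6 * (Fintype.card (Fol L) : ℝ)) * R ^ 2 / 2)
    (hsmall₂ : 2 * B₄ * R ^ 2 ≤ κ / (2304 * (L : ℝ) ^ 6 * (Fintype.card (Fol L) : ℝ)) / 2)
    (C : Fin 4 → SU2)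
    (hCC : ∀ μ ν : Fin 3, frobNorm (((C (Fin.castSucc μ) * C (Fin.castSucc ν) : SU2) : Matrix (Fin 2) (Fin 2) ℂ) -
        ((C (Fin.castSucc ν) * C (Fin.castSucc μ) : SU2) : Matrix (Fin 2) (Fin 2) ℂ)) ≤ s)
    (hσ : ∀ μ : Fin 3, frobNorm (((C (Fin.last 3) * C (Fin.castSucc (Equiv.swap (0 : Fin 3) 1 μ)) : SU2) : Matrix (Fin 2) (Fin 2) ℂ) -
        ((C (Fin.castSucc μ) * C (Fin.last 3) : SU2) : Matrix (Fin 2) (Fin 2) ℂ)) ≤ s)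
    {A : V →ₗ[ℝ] V}
    (hT : ∃ σ : V → ℝ, (∀ y, σ (-y) = -σ y) ∧ ∀ y : V, ‖y‖ ≤ R →
      |chartDeficit L (fun _ => false) (fun _ => 1) (C, Ψ y) - chartDeficit L (fun _ => false) (fun _ => 1) (C, fun _ => 1) -
          (1 / 2) * ⟪A y, y⟫_ℝ - σ y| ≤ B₄ * ‖y‖ ^ 4)
    (y : V) :
    κ / (2304 * (L : ℝ) ^ 6 * (Fintype.card (Fol L) : ℝ)) * ‖y‖ ^ 2 ≤ ⟪A y, y⟫_ℝ := by
  have h := follower_coercivity_of_taylor (L := L) Ψ hR hs hΨ C hCC hσ hT y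
  have hR2 : 0 < R ^ 2 := by positivity
  set μ : ℝ := κ / (2304 * (L : ℝ) ^ 6 * (Fintype.card (Fol L) : ℝ)) with hμ
  have h1 : 2 * (300 * (L : ℝ) ^ 4 * s ^ 2) / R ^ 2 ≤ μ / 2 := by
    rw [div_le_iff₀ hR2]
    calc 2 * (300 * (L : ℝ) ^ 4 * s ^ 2) ≤ μ * R ^ 2 / 2 := hsmall₁
      _ = μ / 2 * R ^ 2 := by ring
  have hcoef : μ ≤ 2 * μ - 2 * (300 * (L : ℝ) ^ 4 * s ^ 2) / R ^ 2 - 2 * B₄ * R ^ 2 := by linarith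
  calc μ * ‖y‖ ^ 2 ≤ (2 * μ - 2 * (300 * (L : ℝ) ^ 4 * s ^ 2) / R ^ 2 - 2 * B₄ * R ^ 2) * ‖y‖ ^ 2 :=
        mul_le_mul_of_nonneg_right hcoef (by positivity)
    _ ≤ _ := h

end Summit.QuantumFields.YangMills.Theorems.SwapVirialDeficit.BlowUpRing

end
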